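import Summits.Ventures.PercRepro.ProfileGapMonoThresholdTopClimb

/-!
# PercRepro — THE TOP THRESHOLD ON EVERY MATROID WHOSE CORE QUALIFIES (p5, gen 31; `proofs/P5-GM1.md` §42)

`thresholdIneq_top_of_coloop` / `thresholdIneq_top_of_loop` (TopClimb) climb one coloop or loop at a time.  Here the
climb is iterated over a finset `W` of coloops and loops: deleting one of them keeps every other coloop a coloop
(`rk_erase_add_one_of_subset`: a coloop of a set is a coloop of every subset containing it) and every loop a loop
(`rk_delete`), so `(I_{ρ−1})` of `N ∖ W` gives `(I_{ρ−1})` of `N` — **`thresholdIneq_top_of_delete_core`** (`2 ≤ q`,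
`2 ≤ ρ(N ∖ W)`).  Composed with `thresholdIneq_top_of_long_flat`: **`thresholdIneq_top_of_core_long_flat`** — the top
threshold of the co-rank-`q` family holds on EVERY matroid whose coloop-free core `N ∖ W` has rank `≥ q` and a
rank-`(q−1)` flat of `ν + q − 2` points (`ν` the nullity of the core), for every `q ≥ 2`.  At `q = 4` the dichotomy
**`thresholdIneq_four_top_of_no_nu_one_plane`**: on a coloop-free matroid of rank `≥ 4` with NO plane of exactly
`ν + 1` points the top threshold holds (some plane has `ν + 2` points: TopNuTwo; none has `ν + 1` or `ν + 2`:
FlatBound), and its core form `thresholdIneq_four_top_of_core_no_nu_one_plane`.  Nothing open is asserted.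
-/

open scoped Matroid

namespace PercRepro.Cogirth

open Finset ThmH Skew Shadow Profile

variable {α : Type} [DecidableEq α] {N : Matroid α} [N.Finite] {q : ℕ}

omit [DecidableEq α] in
/-- `rk` is the same on equal matroids (whatever the finiteness instances). -/
theorem rk_congr {M₁ M₂ : Matroid α} [M₁.Finite] [M₂.Finite] (h : M₁ = M₂) (X : Finset α) :
    rk M₁ X = rk M₂ X := by
  subst h
  rfl

omit [DecidableEq α] in
/-- `gr` is the same on equal matroids. -/
theorem gr_congr {M₁ M₂ : Matroid α} [M₁.Finite] [M₂.Finite] (h : M₁ = M₂) : gr M₁ = gr M₂ := by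
  subst h
  rfl

/-- `ThresholdIneq` is the same on equal matroids. -/
theorem thresholdIneq_congr {M₁ M₂ : Matroid α} [M₁.Finite] [M₂.Finite] (h : M₁ = M₂) (q t : ℕ) :
    ThresholdIneq M₁ q t ↔ ThresholdIneq M₂ q t := by
  subst h
  exact Iff.rfl

/-- **A coloop of a set is a coloop of every subset containing it**: `rk (S ∖ z) + 1 = rk S` and `z ∈ S' ⊆ S`
give `rk (S' ∖ z) + 1 = rk S'`. -/
theorem rk_erase_add_one_of_subset {S S' : Finset α} {z : α} (hS : S ⊆ gr N) (hS' : S' ⊆ S) (hz : z ∈ S')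
    (h : rk N (S.erase z) + 1 = rk N S) : rk N (S'.erase z) + 1 = rk N S' := by
  have hzg : z ∈ gr N := hS (hS' hz)
  have h1 := rk_insert_eq hzg ((erase_subset z S').trans (hS'.trans hS))
  rw [insert_erase hz] at h1
  have h2 := rk_insert_eq hzg ((erase_subset z S).trans hS)
  rw [insert_erase (hS' hz)] at h2
  have hnot : z ∉ clF N (S.erase z) := by
    intro hc
    rw [if_pos hc] at h2
    omega
  have hnot' : z ∉ clF N (S'.erase z) := fun hc => hnot (clF_mono (erase_subset_erase z hS') hc)
  rw [if_neg hnot'] at h1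
  omega

/-- **Deleting any other point keeps a coloop a coloop and a loop a loop**: for `w ≠ z` in `E`, a coloop (loop) `w`
of `N` is a coloop (loop) of `N ∖ z`. -/
theorem coloop_or_loop_delete {z w : α} (hw : w ∈ gr N) (hwz : w ≠ z)
    (h : rk N ((gr N).erase w) + 1 = rk N (gr N) ∨ rk N {w} = 0) :
    rk (N ＼ ({z} : Set α)) ((gr (N ＼ ({z} : Set α))).erase w) + 1 = rk (N ＼ ({z} : Set α)) (gr (N ＼ ({z} : Set α))) ∨
      rk (N ＼ ({z} : Set α)) {w} = 0 := by
  have hwz' : w ∈ (gr N).erase z := mem_erase.2 ⟨hwz, hw⟩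
  rcases h with h | h
  · left
    rw [gr_delete', rk_delete (erase_subset w _), rk_delete (Subset.refl _)]
    exact rk_erase_add_one_of_subset (Subset.refl _) (erase_subset z (gr N)) hwz' h
  · right
    rw [rk_delete (singleton_subset_iff.2 hwz')]
    exact h

/-- The rank of `N ∖ W` is at most the rank of `N` (finset deletions, one point at a time). -/
theorem rk_gr_delete_finset_le (W : Finset α) :
    ∀ (N : Matroid α) [N.Finite], rk (N ＼ (W : Set α)) (gr (N ＼ (W : Set α))) ≤ rk N (gr N) := by
  induction W using Finset.induction_on with
  | empty =>
    intro N _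
    simp only [coe_empty, Matroid.delete_empty, le_refl]
  | insert z W hzW ih =>
    intro N _
    have hEq : N ＼ ((insert z W : Finset α) : Set α) = (N ＼ ({z} : Set α)) ＼ (W : Set α) := by
      rw [Matroid.delete_delete, coe_insert, Set.insert_eq]
    rw [rk_congr hEq, gr_congr hEq]
    refine (ih (N ＼ ({z} : Set α))).trans ?_
    rw [gr_delete', rk_delete (Subset.refl _)]
    exact rk_mono' (erase_subset z (gr N))

/-- **THE TOP THRESHOLD CLIMBS THROUGH A FINSET OF COLOOPS AND LOOPS** (`2 ≤ q`): if every point of `W ⊆ E` is a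
coloop or a loop of `N`, the deletion `N ∖ W` has rank `≥ 2`, and `(I_{ρ(N∖W)−1})` holds for `N ∖ W`, then
`(I_{ρ(E)−1})` holds for `N`. -/
theorem thresholdIneq_top_of_delete_core (hq : 2 ≤ q) (W : Finset α) :
    ∀ (N : Matroid α) [N.Finite], W ⊆ gr N →
      (∀ z ∈ W, rk N ((gr N).erase z) + 1 = rk N (gr N) ∨ rk N {z} = 0) →
      2 ≤ rk (N ＼ (W : Set α)) (gr (N ＼ (W : Set α))) →
      ThresholdIneq (N ＼ (W : Set α)) q (rk (N ＼ (W : Set α)) (gr (N ＼ (W : Set α))) - 1) →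
      ThresholdIneq N q (rk N (gr N) - 1) := by
  induction W using Finset.induction_on with
  | empty =>
    intro N _ _ _ _ h
    simpa only [coe_empty, Matroid.delete_empty] using h
  | insert z W hzW ih =>
    intro N _ hW hcl hR h
    have hEq : N ＼ ((insert z W : Finset α) : Set α) = (N ＼ ({z} : Set α)) ＼ (W : Set α) := by
      rw [Matroid.delete_delete, coe_insert, Set.insert_eq]
    rw [rk_congr hEq, gr_congr hEq] at hR
    rw [thresholdIneq_congr hEq, rk_congr hEq, gr_congr hEq] at h
    have hz : z ∈ gr N := hW (mem_insert_self z W)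
    have hW' : W ⊆ gr (N ＼ ({z} : Set α)) := by
      rw [gr_delete']
      intro w hw
      exact mem_erase.2 ⟨fun hwz => hzW (hwz ▸ hw), hW (mem_insert_of_mem hw)⟩
    have hcl' : ∀ w ∈ W, rk (N ＼ ({z} : Set α)) ((gr (N ＼ ({z} : Set α))).erase w) + 1 =
        rk (N ＼ ({z} : Set α)) (gr (N ＼ ({z} : Set α))) ∨ rk (N ＼ ({z} : Set α)) {w} = 0 := fun w hw =>
      coloop_or_loop_delete (hW (mem_insert_of_mem hw)) (fun hwz => hzW (hwz ▸ hw)) (hcl w (mem_insert_of_mem hw))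
    have h' := ih (N ＼ ({z} : Set α)) hW' hcl' hR h
    have hR' : 2 ≤ rk (N ＼ ({z} : Set α)) (gr (N ＼ ({z} : Set α))) :=
      hR.trans (rk_gr_delete_finset_le W (N ＼ ({z} : Set α)))
    rcases hcl z (mem_insert_self z W) with hzc | hzl
    · have hR2 : 2 ≤ rk N (gr N) := by
        have := rk_gr_delete_of_coloop hzc
        omega
      exact thresholdIneq_top_of_coloop hz hzc hq hR2 h'
    · have hrk : rk (N ＼ ({z} : Set α)) (gr (N ＼ ({z} : Set α))) = rk N (gr N) := by
        rw [gr_delete', rk_delete (Subset.refl _), rk_erase_of_loop hz hzl (Subset.refl _)]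
      rw [hrk] at h'
      exact thresholdIneq_top_of_loop hz hzl h'

/-- **THE TOP THRESHOLD OF THE CO-RANK-`q` FAMILY ON EVERY MATROID WHOSE CORE HAS A LONG FLAT** (`2 ≤ q`): if every
point of `W ⊆ E` is a coloop or a loop of `N`, the core `N ∖ W` is coloop-free of rank `≥ q` and has a rank-`(q−1)` flat
`cl B` of `ν(N ∖ W) + q − 2` points, then `ThresholdIneq N q (ρ(E) − 1)`. -/
theorem thresholdIneq_top_of_core_long_flat (hq : 2 ≤ q) {W : Finset α} (hW : W ⊆ gr N)
    (hcl : ∀ z ∈ W, rk N ((gr N).erase z) + 1 = rk N (gr N) ∨ rk N {z} = 0)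
    (hcf : ∀ z ∈ gr (N ＼ (W : Set α)), rk (N ＼ (W : Set α)) ((gr (N ＼ (W : Set α))).erase z) =
      rk (N ＼ (W : Set α)) (gr (N ＼ (W : Set α))))
    {B : Finset α} (hB : B ∈ Rq (N ＼ (W : Set α)) (q - 1))
    (hlong : (clF (N ＼ (W : Set α)) B).card + rk (N ＼ (W : Set α)) (gr (N ＼ (W : Set α))) =
      (gr (N ＼ (W : Set α))).card + (q - 2))
    (hR : q ≤ rk (N ＼ (W : Set α)) (gr (N ＼ (W : Set α)))) : ThresholdIneq N q (rk N (gr N) - 1) :=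
  thresholdIneq_top_of_delete_core hq W N hW hcl (by omega) (thresholdIneq_top_of_long_flat hq hcf hB hlong hR)

/-- **THE TOP THRESHOLD AT `q = 4` ON A COLOOP-FREE MATROID WITH NO PLANE OF EXACTLY `ν + 1` POINTS** (rank `≥ 4`):
some plane has `ν + 2` points (TopNuTwo) or no plane has `ν + 1` or `ν + 2` points (FlatBound). -/
theorem thresholdIneq_four_top_of_no_nu_one_plane (hcf : ∀ z ∈ gr N, rk N ((gr N).erase z) = rk N (gr N))
    (hR : 4 ≤ rk N (gr N)) (h : ∀ B ∈ Rq N 3, (clF N B).card + rk N (gr N) ≠ (gr N).card + 1) :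
    ThresholdIneq N 4 (rk N (gr N) - 1) := by
  by_cases hex : ∃ B ∈ Rq N 3, (clF N B).card + rk N (gr N) = (gr N).card + 2
  · obtain ⟨B, hB, hl⟩ := hex
    exact thresholdIneq_four_top_of_long_plane hcf hB hl hR
  · refine thresholdIneq_of_no_long_flat (q := 4) (by norm_num) hcf hR ?_
    intro B hB
    have h1 := h B hB
    have h2 : (clF N B).card + rk N (gr N) ≠ (gr N).card + 2 := fun heq => hex ⟨B, hB, heq⟩
    omega

/-- **THE TOP THRESHOLD AT `q = 4` ON EVERY MATROID WHOSE CORE HAS RANK `≥ 4` AND NO PLANE OF EXACTLY `ν + 1`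
POINTS**: `W ⊆ E` a finset of coloops and loops of `N`, the core `N ∖ W` coloop-free. -/
theorem thresholdIneq_four_top_of_core_no_nu_one_plane {W : Finset α} (hW : W ⊆ gr N)
    (hcl : ∀ z ∈ W, rk N ((gr N).erase z) + 1 = rk N (gr N) ∨ rk N {z} = 0)
    (hcf : ∀ z ∈ gr (N ＼ (W : Set α)), rk (N ＼ (W : Set α)) ((gr (N ＼ (W : Set α))).erase z) =
      rk (N ＼ (W : Set α)) (gr (N ＼ (W : Set α))))
    (hR : 4 ≤ rk (N ＼ (W : Set α)) (gr (N ＼ (W : Set α))))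
    (h : ∀ B ∈ Rq (N ＼ (W : Set α)) 3, (clF (N ＼ (W : Set α)) B).card + rk (N ＼ (W : Set α)) (gr (N ＼ (W : Set α))) ≠
      (gr (N ＼ (W : Set α))).card + 1) : ThresholdIneq N 4 (rk N (gr N) - 1) :=
  thresholdIneq_top_of_delete_core (by norm_num) W N hW hcl (by omega)
    (thresholdIneq_four_top_of_no_nu_one_plane hcf hR h)

end PercRepro.Cogirth
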